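import Mathlib
import HarnessLib
import Literature.Analysis.FluidPDE.NSBoundedMildOseen
import Literature.Analysis.FluidPDE.NSBoundedMildSmoothing
import Literature.Analysis.FluidPDE.KNSSLocalSmoothingHolds
import Literature.Analysis.UnboundedOperators.HeatKernel
import Summits.NavierStokesRegularity.NavierStokesRegularity.Theorems.UnthreadedRigidityDoorUnthreadedRigidityPrecessionFastW2

/-!
# Route `UnthreadedRigidityDoor`, item `UnthreadedRigidity` (W2, stmt-NavierStokesRegularity-27585) — crux idea «precession-gap» (ns-idea-15, sketch v3),
# REGULARITY SOURCE P3 `BoundedHonestMildSlicesC2` DISCHARGED: a bounded, continuous, measurable-sliced, HONEST Oseen-mild eternal solution is jointly `C²`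

Cell ns-regularity-ideate, seat ns-poloidal-K2-p2 g12 (hand for the precession rungs; `--supports` the W2 item).  Statement = the body of
`Precession.BoundedHonestMildSlicesC2` (PrecessionSketch v3 l.292) VERBATIM up to unfolding the sketch-local `IsOseenMildOn univ u` exactly as in
rung G (`…PrecessionFastW2.fastPrecessionUnthreadedRigidity_of_shortPeriodCollapse`, p675054, hypothesis `hP3`).

PROOF (KNSS 2009 Prop. 4.1 BY NAME).  Fix `(t₀, x₀)`; `M := max B 1`; `(ε, C)` := the constants of
`Literature.Analysis.FluidPDE.knss2009_local_smoothing_holds` for `(k, l) = (2, 0)`; window `(s′, s′ + ε/M²)` with `s′ := t₀ − ε/(2M²)`.  The honest identity from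
time `s′` says `u` solves the Oseen integral equation from the datum `u(s′)` (`‖u(s′)‖_∞ ≤ M`) on the window, so
`Literature.Analysis.FluidPDE.exists_local_smooth_representative` (the local `C²` solution of (L) + uniqueness of bounded solutions) gives a jointly `C²` `v`
with `u(t) = v(t)` a.e. for every `t` in the window; both slices are continuous, hence equal (`Continuous.ae_eq_iff_eq`), so `uncurry u = uncurry v` on the
open window slab, and `uncurry u` is `C²` at `(t₀, x₀)`.  COROLLARY: rung G with P3 discharged — `fastPrecessionUnthreadedRigidity_of_shortPeriodCollapse'
(hD) : «G»`, conditional on D `ShortPeriodCollapse` ALONE.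

WHAT THIS IS NOT: D is NOT proved; G stays CONDITIONAL (on D); items 27585 / 1222 / 19708 OPEN; no claim about Navier–Stokes regularity.
-/

noncomputable section

-- the summit and its single sub-problem share the name (CONVENTIONS §1), as in every Theorems file
set_option linter.dupNamespace false

namespace Summit.NavierStokesRegularity.NavierStokesRegularity.Theorems.UnthreadedRigidityDoorUnthreadedRigidityPrecessionSlicesC2

open MeasureTheory Set Function Filter Topology
open scoped RealInnerProductSpace InnerProductSpace ENNReal
open Literature.Analysis Literature.Analysis.FluidPDE Literature.Analysis.UnboundedOperators
open Summit.NavierStokesRegularity.NavierStokesRegularity.Theorems.UnthreadedRigidityDoorUnthreadedRigidityPrecessionFastW2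

/-- **P3 `BoundedHonestMildSlicesC2` (VERBATIM body, `IsOseenMildOn univ` unfolded): a bounded, jointly continuous, measurable-sliced, honest
Oseen-mild eternal solution is jointly `C²`.** [cite: KochNadirashviliSereginSverak2009, Prop. 4.1 (arXiv:0709.3599 p. 8)] -/
theorem boundedHonestMildSlicesC2 :
    ∀ (u : ℝ → EuclideanSpace ℝ (Fin 3) → EuclideanSpace ℝ (Fin 3)) (B : ℝ), Continuous (uncurry u) →
      (∀ t, AEStronglyMeasurable (u t) volume) → (∀ t x, ‖u t x‖ ≤ B) →
      (∀ s ∈ (univ : Set ℝ), ∀ t ∈ (univ : Set ℝ), s < t → ∀ x,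
        u t x = heatExtension (u s) (t - s) x - oseenDuhamel 1 s u u t x) →
      ContDiff ℝ 2 (uncurry u) := by
  intro u B hcont hmeas hbdd hmild
  obtain ⟨ε, hε, C, hC, hL⟩ := knss2009_local_smoothing_holds (E := EuclideanSpace ℝ (Fin 3)) 2 0
  set M : ℝ := max B 1 with hM
  have hM0 : 0 < M := lt_of_lt_of_le one_pos (le_max_right _ _)
  have hbM : ∀ t x, ‖u t x‖ ≤ M := fun t x => (hbdd t x).trans (le_max_left _ _)
  have hLinf : ∀ t, eLpNorm (u t) ∞ volume ≤ ENNReal.ofReal M := fun t => by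
    rw [eLpNorm_exponent_top]
    exact eLpNormEssSup_le_of_ae_bound (Eventually.of_forall fun x => hbM t x)
  rw [contDiff_iff_contDiffAt]
  rintro ⟨t₀, x₀⟩
  -- the window `(s', s' + h)` around `t₀`
  have hh : 0 < ε * 1 / M ^ 2 := by positivity
  set s' : ℝ := t₀ - ε * 1 / M ^ 2 / 2 with hs'
  have ht₀1 : s' < t₀ := by rw [hs']; linarith
  have ht₀2 : t₀ < s' + ε * 1 / M ^ 2 := by rw [hs']; linarith
  -- `u` is a bounded measurable solution of the Oseen integral equation from `u(s')` on the window
  have hum : AEStronglyMeasurable (uncurry u)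
      ((volume : Measure (ℝ × EuclideanSpace ℝ (Fin 3))).restrict (Ioo s' (s' + ε * 1 / M ^ 2) ×ˢ univ)) :=
    hcont.aestronglyMeasurable
  have husol : ∀ t ∈ Ioo s' (s' + ε * 1 / M ^ 2), u t =ᵐ[volume] fun x =>
      heatExtension (u s') (1 * (t - s')) x - oseenDuhamel 1 s' u u t x := fun t ht =>
    Eventually.of_forall fun x => by
      rw [one_mul]; exact hmild s' (mem_univ _) t (mem_univ _) ht.1 x
  obtain ⟨v, hvs, hae, -, -, -⟩ := exists_local_smooth_representative (k := 2) (l := 0) hL one_pos hM0 hC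
    (hmeas s') (hLinf s') hum (fun t _ => hLinf t) husol
  rw [min_self] at hae
  -- continuous slices a.e. equal are equal
  have hslice : ∀ t ∈ Ioo s' (s' + ε * 1 / M ^ 2), u t = v t := by
    intro t ht
    have hvt : Continuous (v t) :=
      hvs.continuousOn.comp_continuous (continuous_const.prodMk continuous_id) fun x => ⟨ht, mem_univ _⟩
    have hut : Continuous (u t) := hcont.comp (continuous_const.prodMk continuous_id)
    exact (Continuous.ae_eq_iff_eq volume hut hvt).1 (hae t ht)
  have heq : ∀ p ∈ Ioo s' (s' + ε * 1 / M ^ 2) ×ˢ (univ : Set (EuclideanSpace ℝ (Fin 3))), uncurry u p = uncurry v p := by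
    rintro ⟨t, x⟩ ⟨ht, -⟩
    simp only [uncurry_apply_pair, hslice t ht]
  have hu2 : ContDiffOn ℝ 2 (uncurry u) (Ioo s' (s' + ε * 1 / M ^ 2) ×ˢ univ) := (hvs.congr heq)
  exact hu2.contDiffAt (prod_mem_nhds (Ioo_mem_nhds ht₀1 ht₀2) univ_mem)

/-- **RUNG G with P3 discharged**: `FastPrecessionUnthreadedRigidity` (body VERBATIM as in p675054) from D `ShortPeriodCollapse` ALONE. -/
theorem fastPrecessionUnthreadedRigidity_of_shortPeriodCollapse'
    (hD : ∃ c₀ : ℝ, 0 < c₀ ∧ ∀ (u : ℝ → EuclideanSpace ℝ (Fin 3) → EuclideanSpace ℝ (Fin 3)) (P B : ℝ), 0 < P →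
      ContDiff ℝ 2 (uncurry u) → (∀ t, VectorCalculus.IsDivFree (u t)) → (∀ t x, ‖u t x‖ ≤ B) →
      (∀ s ∈ (univ : Set ℝ), ∀ t ∈ (univ : Set ℝ), s < t → ∀ x,
        u t x = heatExtension (u s) (t - s) x - oseenDuhamel 1 s u u t x) →
      (∀ t x, u (t + P) x = u t x) → P * B ^ 2 ≤ c₀ → ∀ s t x, u s x = u t x) :
    ∃ C : ℝ, 0 < C ∧ ∀ (u : ℝ → EuclideanSpace ℝ (Fin 3) → EuclideanSpace ℝ (Fin 3)) (x₀ : EuclideanSpace ℝ (Fin 3)) (Ω B : ℝ)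
      (V : EuclideanSpace ℝ (Fin 3) → EuclideanSpace ℝ (Fin 3)),
      Continuous (uncurry u) → (∀ t, VectorCalculus.IsDivFree (u t)) →
      (∀ s ∈ (univ : Set ℝ), ∀ t ∈ (univ : Set ℝ), s < t → ∀ x,
        u t x = heatExtension (u s) (t - s) x - oseenDuhamel 1 s u u t x) →
      (∀ t x, u t x = rotZ (Ω * t) (V (rotZ (-(Ω * t)) (x - x₀)))) → (∀ x, ‖V x‖ ≤ B) → C * B ^ 2 ≤ |Ω| →
      (∀ t x, inner ℝ (curl (u t) x) (x - x₀) = 0) →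
      ∃ A : EuclideanSpace ℝ (Fin 3) →L[ℝ] EuclideanSpace ℝ (Fin 3), (∀ x, inner ℝ (A x) x = 0) ∧ A ≠ 0 ∧
        ∀ t x, fderiv ℝ (u t) x (A (x - x₀)) - A (u t x) = 0 :=
  fastPrecessionUnthreadedRigidity_of_shortPeriodCollapse hD boundedHonestMildSlicesC2

end Summit.NavierStokesRegularity.NavierStokesRegularity.Theorems.UnthreadedRigidityDoorUnthreadedRigidityPrecessionSlicesC2
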